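import Literature.ModelTheory.FiniteModelTheory.CohomologicalConsistencyComplexity
import Literature.ModelTheory.FiniteModelTheory.CohomologicalConsistencyDecision
import Literature.Computability.Complexity.IntegerLinearSolvabilityFP
import Literature.Computability.Complexity.RowSelectFP
import Literature.Computability.Complexity.CodeFPLists
import Literature.Computability.Complexity.CodeFPFinite
import Literature.Computability.Complexity.HamCircuitNP
import Literature.Computability.Complexity.LengthCompare
import HarnessLib

/-!
# Cohomological `k`-consistency of graphs is decidable in polynomial time — proof of the named fact

Topic `Literature/ModelTheory/FiniteModelTheory`.  Discharge of the named fact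
`graphCohomologicalKConsistency_mem_P` (`CohomologicalConsistencyComplexity.lean`; Ó Conghaile 2022,
§4.2–§4.3.1 and Appendix, proof of Prop. "efficient"): for every fixed level `k` and fixed template
graph `H` on `Fin q`, the language of codes of finite graphs `G` with `G →^ℤ_k H` is in `P`.

The proof runs the list program `GCKCDecide.decideL` of `CohomologicalConsistencyDecision.lean`
(proved there to decide `GraphCohomologicallyKConsistent k G H`) by a polynomial-time string function
in the typed `FP` algebra `CodeFP`, the `ℤext` tests by the polynomial-time decision of linear
Diophantine systems `IntSolveFP.intSolvable_codeFP` (`IntegerLinearSolvabilityFP.lean`), exactly as in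
the printed proof ("a system of polynomially many linear equations … solved in polynomial time by an
algorithm of Kannan and Bachem"; at most `|𝓗_k|` rounds).  Points of the machine realisation:

* the number of vertices enters the program in UNARY as `min n |bits|` (equal to `n` on genuine graph
  codes `⟨bin n, n² adjacency bits⟩`), so that every enumeration (`levels`, `upTo`, `incLists`,
  `subl`, `colourings` — all by recursion on the fixed level, realised by induction without loops of
  data-dependent length) is polynomial on every input string;
* adjacency of `G` is read off the bit string (`adjGfun`: bit `n i + j`), adjacency of the fixed `H`
  is a finite table (`adjHfun`, `CodeFP.ofFintype₂`);
* the only genuine loop, the `|𝓗_k| + 1` rounds of `(·)^{ℤ↓}`, keeps a sublist of `𝓗_k` as its state;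
* **`graphCohomologicalKConsistency_mem_P_holds`**: the language is the intersection of the graph-code
  language (`HamNP.gcodeT`) with the strings accepted by the program, decided by one `FP` function
  (`mem_P_of_mem_FP`).

## References

* A. Ó Conghaile, *Cohomology in Constraint Satisfaction and Structure Isomorphism*, MFCS 2022,
  LIPIcs 241, 75:1–75:16 = arXiv:2206.15253 [OConghaile2022], §4.2, §4.3.1 (Def. 5), Appendix
  (proof of Prop. "efficient").
* R. Kannan, A. Bachem, SIAM J. Comput. 8 (1979) [KannanBachem1979] (linear Diophantine systems in
  polynomial time).
* S. Arora, B. Barak, *Computational Complexity: A Modern Approach*, CUP 2009, §1.3 [AroraBarak2009].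
-/

namespace Literature.ModelTheory.FiniteModelTheory

namespace GCKCFP

open Literature.Computability.Complexity Literature.Computability.Complexity.CodeFP _root_.Computability Polynomial
  SecLists GCKCDecide Literature.LinearAlgebra.Matrix Literature.LinearAlgebra.Matrix.RowSelect
  Literature.LinearAlgebra.Matrix.IntSolve Literature.Computability.Complexity.IntDetFP
  Literature.Computability.Complexity.IntSolveFP

/-! ### Injectivity of the codes -/

/-- The code of sections is injective. [folklore] -/
theorem osecE_injective : Function.Injective (rawE (optE natE) : OSec → List Bool) :=
  rawE_injective (optE_injective natE_injective)

/-- The code of vertex lists is injective. [folklore] -/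
theorem vlE_injective : Function.Injective (rawE natE : List ℕ → List Bool) := rawE_injective natE_injective

/-! ### Basic list operations on sections -/

/-- `blank` on codes (unary `n`). [cite: AroraBarak2009, §1.3] -/
theorem blank_codeFP : CodeFP unE (rawE (optE natE)) blank :=
  ((replicateOf (optE natE)).comp ((const _ (none : Option ℕ)).pair (CodeFP.id _))).congr fun _ => rfl

/-- `domL` on codes. [cite: AroraBarak2009, §1.3] -/
theorem domL_codeFP : CodeFP (rawE (optE natE)) (rawE natE) domL := by
  have hp : CodeFP (pairE (rawE (optE natE)) natE) bitE (fun q => (q.1.getD q.2 none).isSome) :=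
    (optIsSome natE).comp (rawGetD (optE natE) (d := none) rfl)
  exact ((filter (σ := OSec) (eσ := (rawE (optE natE))) (eα := natE) hp).comp ((CodeFP.id _).pair (urange.comp (ulength _)))).congr
    fun _ => rfl

/-- `restrL` on codes. [cite: AroraBarak2009, §1.3] -/
theorem restrL_codeFP : CodeFP (pairE (rawE (optE natE)) (rawE natE)) (rawE (optE natE)) (fun p => restrL p.1 p.2) := by
  have hg : CodeFP (pairE (rawE natE) (pairE natE (optE natE))) (optE natE) (fun t => if decide (t.2.1 ∈ t.1) then t.2.2 else none) :=
    ((mem natE_injective).comp ((snd _ _).fst'.pair (fst _ _))).ite (snd _ _).snd' (const _ none)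
  refine ((mapIdx (σ := List ℕ) (eσ := (rawE natE)) (eα := optE natE) hg).comp ((snd _ _).pair (fst _ _))).congr fun p => ?_
  simp only [restrL, decide_eq_true_eq]

/-- Boolean equality of sections on codes. [folklore] -/
theorem beqO_codeFP : CodeFP (pairE (rawE (optE natE)) (rawE (optE natE))) bitE (fun p => p.1 == p.2) := beq osecE_injective

/-- Boolean equality of vertex lists on codes. [folklore] -/
theorem beqV_codeFP : CodeFP (pairE (rawE natE) (rawE natE)) bitE (fun p => p.1 == p.2) := beq vlE_injective

/-- Colouring a position with every colour: `((t, v)) ↦ [t.set v (some c) | c < q]`. [cite: AroraBarak2009, §1.3] -/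
theorem setAll_codeFP (q : ℕ) : CodeFP (pairE (rawE (optE natE)) natE) (rawE (rawE (optE natE))) (fun p => (List.range q).map fun c => p.1.set p.2 (some c)) := by
  have hg : CodeFP (pairE (pairE (rawE (optE natE)) natE) natE) (rawE (optE natE)) (fun t => t.1.1.set t.1.2 (some t.2)) :=
    (setAt (optE natE)).comp ((fst _ _).fst'.pair ((fst _ _).snd'.pair ((optSome natE).comp (snd _ _))))
  exact ((map (σ := OSec × ℕ) (eσ := pairE (rawE (optE natE)) natE) (eα := natE) hg).comp ((CodeFP.id _).pair (const _ (List.range q)))).congr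
    fun _ => rfl

/-! ### The enumerations -/

/-- `exts q` on codes (unary `n`). [cite: AroraBarak2009, §1.3] -/
theorem exts_codeFP (q : ℕ) : CodeFP (pairE unE (rawE (optE natE))) (rawE (rawE (optE natE))) (fun p => exts q p.1 p.2) := by
  let tE := pairE unE (rawE (optE natE))
  -- the admissible new vertices `(range n).filter (fun v => (domL t).all (· < v))`
  have hall : CodeFP (pairE natE (rawE natE)) bitE (fun q => q.2.all fun i => decide (i < q.1)) :=
    all (σ := ℕ) (eσ := natE) (eα := natE) (p := fun q => decide (q.2 < q.1)) (natLt.comp ((snd _ _).pair (fst _ _)))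
  have hpred : CodeFP (pairE (rawE (optE natE)) natE) bitE (fun q => (domL q.1).all fun i => decide (i < q.2)) :=
    (hall.comp ((snd _ _).pair (domL_codeFP.comp (fst _ _)))).congr fun _ => rfl
  have hvs : CodeFP tE (rawE natE) (fun p => (List.range p.1).filter fun v => (domL p.2).all fun i => decide (i < v)) :=
    ((filter (σ := OSec) (eσ := (rawE (optE natE))) (eα := natE) hpred).comp ((snd _ _).pair (urange.comp (fst _ _)))).congr fun _ => rfl
  have hmap := map (σ := OSec) (eσ := (rawE (optE natE))) (eα := natE) (setAll_codeFP q)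
  exact (((flatten _).comp (hmap.comp ((snd _ _).pair hvs))).congr fun p => by rw [exts, List.flatMap_def])

/-- `levels q · j` on codes (unary `n`). [cite: AroraBarak2009, §1.3] -/
theorem levels_codeFP (q : ℕ) : ∀ j : ℕ, CodeFP unE (rawE (rawE (optE natE))) (fun n => levels q n j)
  | 0 => ((rawSingleton (rawE (optE natE))).comp blank_codeFP).congr fun _ => rfl
  | j + 1 => by
    have hmap := map (σ := ℕ) (eσ := unE) (eα := (rawE (optE natE))) (exts_codeFP q)
    exact (((flatten _).comp (hmap.comp ((CodeFP.id _).pair (levels_codeFP q j)))).congr fun n => by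
      rw [levels, List.flatMap_def]; rfl)

/-- `upTo` unrolled. [folklore] -/
theorem upTo_succ (q n k : ℕ) : upTo q n (k + 1) = upTo q n k ++ levels q n (k + 1) := by
  rw [upTo, upTo, List.range_succ, List.flatMap_append, List.flatMap_singleton]

/-- `upTo q · k` on codes (unary `n`). [cite: AroraBarak2009, §1.3] -/
theorem upTo_codeFP (q : ℕ) : ∀ k : ℕ, CodeFP unE (rawE (rawE (optE natE))) (fun n => upTo q n k)
  | 0 => (levels_codeFP q 0).congr fun n => by simp [upTo]
  | k + 1 => ((rawAppend (rawE (optE natE))).comp ((upTo_codeFP q k).pair (levels_codeFP q (k + 1)))).congr fun n => by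
      rw [upTo_succ]

/-- `incLists · j` on codes (unary `n`). [cite: AroraBarak2009, §1.3] -/
theorem incLists_codeFP : ∀ j : ℕ, CodeFP unE (rawE (rawE natE)) (fun n => incLists n j)
  | 0 => (const _ [[]]).congr fun _ => rfl
  | j + 1 => by
    -- `g (n, l) = ((range n).filter (fun v => l.all (· < v))).map (fun v => l ++ [v])`
    have hall : CodeFP (pairE natE (rawE natE)) bitE (fun q => q.2.all fun i => decide (i < q.1)) :=
      all (σ := ℕ) (eσ := natE) (eα := natE) (p := fun q => decide (q.2 < q.1)) (natLt.comp ((snd _ _).pair (fst _ _)))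
    have hpred : CodeFP (pairE (rawE natE) natE) bitE (fun q => q.1.all fun i => decide (i < q.2)) := (hall.comp ((snd _ _).pair (fst _ _))).congr fun _ => rfl
    have hvs : CodeFP (pairE unE (rawE natE)) (rawE natE) (fun p => (List.range p.1).filter fun v => p.2.all fun i => decide (i < v)) :=
      ((filter (σ := List ℕ) (eσ := (rawE natE)) (eα := natE) hpred).comp ((snd _ _).pair (urange.comp (fst _ _)))).congr fun _ => rfl
    have happ : CodeFP (pairE (rawE natE) natE) (rawE natE) (fun q => q.1 ++ [q.2]) := ((rawAppend natE).comp ((fst _ _).pair ((rawSingleton natE).comp (snd _ _)))).congr fun _ => rfl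
    have hg : CodeFP (pairE unE (rawE natE)) (rawE (rawE natE)) (fun p => ((List.range p.1).filter fun v => p.2.all fun i => decide (i < v)).map fun v => p.2 ++ [v]) :=
      ((map (σ := List ℕ) (eσ := (rawE natE)) (eα := natE) happ).comp ((snd _ _).pair hvs)).congr fun _ => rfl
    have hmap := map (σ := ℕ) (eσ := unE) (eα := (rawE natE)) hg
    exact (((flatten _).comp (hmap.comp ((CodeFP.id _).pair (incLists_codeFP j)))).congr fun n => by
      rw [incLists, List.flatMap_def]; rfl)

/-- `domsUpTo` unrolled. [folklore] -/
theorem domsUpTo_succ (n k : ℕ) : domsUpTo n (k + 1) = domsUpTo n k ++ incLists n (k + 1) := by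
  rw [domsUpTo, domsUpTo, List.range_succ, List.flatMap_append, List.flatMap_singleton]

/-- `domsUpTo · k` on codes (unary `n`). [cite: AroraBarak2009, §1.3] -/
theorem domsUpTo_codeFP : ∀ k : ℕ, CodeFP unE (rawE (rawE natE)) (fun n => domsUpTo n k)
  | 0 => (incLists_codeFP 0).congr fun n => by simp [domsUpTo]
  | k + 1 => ((rawAppend (rawE natE)).comp ((domsUpTo_codeFP k).pair (incLists_codeFP (k + 1)))).congr fun n => by rw [domsUpTo_succ]

/-- `subl k` on codes. [cite: AroraBarak2009, §1.3] -/
theorem subl_codeFP : ∀ k : ℕ, CodeFP (rawE natE) (rawE (rawE natE)) (subl k)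
  | 0 => (const _ [[]]).congr fun l => by cases l <;> rfl
  | k + 1 => by
    have hcons : CodeFP (pairE unitE (pairE natE (rawE natE))) (rawE (rawE natE)) (fun t => (subl k t.2.2).map (t.2.1 :: ·) ++ subl k t.2.2) := by
      have hmap : CodeFP (pairE natE (rawE (rawE natE))) (rawE (rawE natE)) (fun q => q.2.map (q.1 :: ·)) :=
        map (σ := ℕ) (eσ := natE) (eα := (rawE natE)) (g := fun t => t.1 :: t.2) (rawCons natE)
      have hs : CodeFP (pairE unitE (pairE natE (rawE natE))) (rawE (rawE natE)) (fun t => subl k t.2.2) := (subl_codeFP k).comp (snd _ _).snd'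
      exact (rawAppend (rawE natE)).comp ((hmap.comp ((snd _ _).fst'.pair hs)).pair hs)
    have h := rawCases (σ := Unit) (eσ := unitE) (eα := natE) (eδ := (rawE (rawE natE))) (k := fun _ l => subl (k + 1) l)
      (gnil := fun _ => [[]]) (gcons := fun t => (subl k t.2.2).map (t.2.1 :: ·) ++ subl k t.2.2)
      (const _ [[]]) hcons (fun _ => rfl) (fun _ _ _ => rfl)
    exact (h.comp ((const _ ()).pair (CodeFP.id _))).congr fun _ => rfl

/-- `colourings q · k ·` on codes (unary `n`). [cite: AroraBarak2009, §1.3] -/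
theorem colourings_codeFP (q : ℕ) : ∀ k : ℕ, CodeFP (pairE unE (rawE natE)) (rawE (rawE (optE natE))) (fun p => colourings q p.1 k p.2)
  | 0 => ((rawSingleton (rawE (optE natE))).comp (blank_codeFP.comp (fst _ _))).congr fun p => by cases p.2 <;> rfl
  | k + 1 => by
    -- cons case: `(colourings q n k Dl').flatMap (fun t => (range q).map (fun c => t.set v (some c)))`
    have hmap := map (σ := ℕ) (eσ := natE) (eα := (rawE (optE natE))) (g := fun t => (List.range q).map fun c => t.2.set t.1 (some c))
      ((setAll_codeFP q).comp ((snd _ _).pair (fst _ _)))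
    have hcons : CodeFP (pairE unE (pairE natE (rawE natE))) (rawE (rawE (optE natE)))
        (fun t => (colourings q t.1 k t.2.2).flatMap fun s => (List.range q).map fun c => s.set t.2.1 (some c)) :=
      ((flatten _).comp (hmap.comp ((snd _ _).fst'.pair ((colourings_codeFP q k).comp ((fst _ _).pair (snd _ _).snd'))))).congr
        fun t => by rw [List.flatMap_def]
    exact rawCases (σ := ℕ) (eσ := unE) (eα := natE) (eδ := (rawE (rawE (optE natE)))) (k := fun n Dl => colourings q n (k + 1) Dl)
      (gnil := fun n => [blank n]) (gcons := fun t => (colourings q t.1 k t.2.2).flatMap fun s => (List.range q).map fun c => s.set t.2.1 (some c))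
      ((rawSingleton (rawE (optE natE))).comp blank_codeFP) hcons (fun _ => rfl) (fun _ _ _ => rfl)

/-! ### Adjacency tests -/

/-- On the adjacency bits of a graph the test is adjacency in `G`. [cite: AroraBarak2009, §0.1] -/
theorem adjGfun_adjBits {n : ℕ} (G : SimpleGraph (Fin n)) (i j : Fin n) : adjGfun n (CliqueNP.adjBits n G) i j = true ↔ G.Adj i j := by
  have hlt : n * i + j < n * n := by
    have := i.isLt; have := j.isLt
    calc n * i + j < n * i + n := by omega
      _ = n * (i + 1) := by ring
      _ ≤ n * n := Nat.mul_le_mul_left n (by omega)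
  have hn : 0 < n := Fin.pos i
  have h1 : Fin.divNat ⟨n * ↑i + ↑j, hlt⟩ = i := by
    apply Fin.ext; simp only [Fin.coe_divNat]
    rw [Nat.add_comm, Nat.add_mul_div_left _ _ hn, Nat.div_eq_of_lt j.isLt, Nat.zero_add]
  have h2 : Fin.modNat ⟨n * ↑i + ↑j, hlt⟩ = j := by
    apply Fin.ext; simp only [Fin.coe_modNat]
    rw [Nat.add_comm, Nat.add_mul_mod_self_left, Nat.mod_eq_of_lt j.isLt]
  unfold adjGfun CliqueNP.adjBits
  rw [List.getD_eq_getElem _ _ (by simpa using hlt), List.getElem_ofFn]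
  simp only [h1, h2, decide_eq_true_eq]

/-- A bit of a string, by the pattern `(w.drop i).take 1 = [true]` (the same one-line fact as
`getD_false_eq_decide` of `Barriers/QuantumAdvantage/AaronsonChenAdviceTables.lean`, restated so as not
to import that unrelated file). [folklore] -/
theorem getD_eq_decide (w : List Bool) (i : ℕ) : w.getD i false = decide ((w.drop i).take 1 = [true]) := by
  by_cases h : i < w.length
  · rw [List.take_one_drop_eq_of_lt_length h, List.getD_eq_getElem _ _ h]
    cases h' : w[i] <;> simp [h']
  · rw [not_lt] at h
    rw [List.getD_eq_default _ _ h, List.drop_eq_nil_of_le h]; simp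

/-- Reading a bit of a string at a binary position (the same brick as `KSatSNP.strGetDNat` of
`Computability/FineGrained/SerfSNPInSNPProofs.lean`, re-derived from `bitAtFn` in four lines so as not to
import the fine-grained SNP development into this file). [cite: AroraBarak2009, §1.3] -/
theorem getBit_codeFP : CodeFP (pairE strE natE) bitE (fun p => p.1.getD p.2 false) := by
  -- `(w, i) ↦ (w.drop (min i |w|)).take 1` by `bitAtFn` on `⟨1^{min i |w|}, w⟩`
  have hun : CodeFP (pairE strE natE) unE (fun p => min p.2 p.1.length) := (unOfNatMin.comp ((strLength.comp (fst _ _)).pair (snd _ _))).congr fun _ => rfl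
  have hbit : CodeFP (pairE unE strE) strE (fun p => (p.2.drop p.1).take 1) :=
    ⟨bitAtFn, bitAtFn_mem_FP, fun p => by rw [pairE_apply, bitAtFn_boolPair, length_unE]; rfl⟩
  have h := (CodeFP.eq (α := List Bool) (eα := strE) Function.injective_id).comp ((hbit.comp (hun.pair (fst _ _))).pair (const _ [true]))
  refine (h.congr fun p => ?_)
  simp only
  rw [getD_eq_decide]
  by_cases hi : p.2 < p.1.length
  · rw [min_eq_left hi.le]
  · rw [not_lt] at hi
    rw [min_eq_right hi, List.drop_eq_nil_of_le hi, List.drop_length]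

/-- The adjacency test of the input on codes (context `(1ⁿ, bits)`, arguments `(i, j)`). [cite: AroraBarak2009, §1.3] -/
theorem adjG_codeFP : CodeFP (pairE (pairE unE strE) (pairE natE natE)) bitE (fun p => adjGfun p.1.1 p.1.2 p.2.1 p.2.2) := by
  let tE := pairE (pairE unE strE) (pairE natE natE)
  have pn : CodeFP tE natE (fun p => p.1.1) := (natOfUn.comp (fst _ _).fst').congr fun _ => rfl
  have hidx : CodeFP tE natE (fun p => p.1.1 * p.2.1 + p.2.2) := (natAdd.comp ((natMul.comp (pn.pair (snd _ _).fst')).pair (snd _ _).snd')).congr fun _ => rfl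
  exact (getBit_codeFP.comp ((fst _ _).snd'.pair hidx)).congr fun _ => rfl

/-- The adjacency table of `H` on codes. [cite: AroraBarak2009, §1.3] -/
theorem adjH_codeFP (q : ℕ) (H : SimpleGraph (Fin q)) : CodeFP (pairE natE natE) bitE (fun p => adjHfun q H p.1 p.2) := by
  classical
  rcases Nat.eq_zero_or_pos q with hq | hq
  · exact (const _ false).congr fun p => by unfold adjHfun; rw [dif_neg (by omega)]
  · -- reduce modulo `q`, then a finite table on `Fin q × Fin q`
    have hfin : CodeFP (pairE (natE ∘ Fin.val) (natE ∘ Fin.val)) bitE (fun c : Fin q × Fin q => decide (H.Adj c.1 c.2)) :=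
      ofFintype₂ (fun a b h => Fin.ext (natE_injective h)) (fun a b h => Fin.ext (natE_injective h)) bitE _
    have hmod : CodeFP (pairE natE natE) (pairE (natE ∘ Fin.val) (natE ∘ Fin.val))
        (fun p => ((⟨p.1 % q, Nat.mod_lt _ hq⟩ : Fin q), (⟨p.2 % q, Nat.mod_lt _ hq⟩ : Fin q))) :=
      (((natMod.comp ((fst _ _).pair (const _ q))).pair (natMod.comp ((snd _ _).pair (const _ q)))).recodeOut fun _ => rfl).congr fun _ => rfl
    exact (hfin.comp hmod).congr fun p => by unfold adjHfun; rw [dif_pos hq]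

/-! ### The hom test and `𝓗_k` -/

/-- `pairOK` by nested case analysis on the two colours. [folklore] -/
theorem pairOK_eq (adjH adjG : ℕ → ℕ → Bool) (p p' : ℕ × Option ℕ) :
    pairOK adjH adjG p p' = (match p.2 with
      | none => true
      | some c => match p'.2 with
        | none => true
        | some d => !(adjG p.1 p'.1) || adjH c d) := by
  obtain ⟨i, o⟩ := p; obtain ⟨j, o'⟩ := p'
  cases o <;> cases o' <;> rfl

variable (k q : ℕ) (H : SimpleGraph (Fin q))

/-- `pairOK` on codes (context `(1ⁿ, bits)`). [cite: AroraBarak2009, §1.3] -/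
theorem pairOK_codeFP :
    CodeFP (pairE (pairE unE strE) (pairE (pairE natE (optE natE)) (pairE natE (optE natE)))) bitE
      (fun t => pairOK (adjHfun q H) (adjGfun t.1.1 t.1.2) t.2.1 t.2.2) := by
  let tE := pairE (pairE unE strE) (pairE (pairE natE (optE natE)) (pairE natE (optE natE)))
  -- inner case analysis on the second colour, context `((ctx, i, j), c)`
  let iE := pairE (pairE (pairE unE strE) (pairE natE natE)) natE
  have hboth : CodeFP (pairE iE natE) bitE (fun s => !(adjGfun s.1.1.1.1 s.1.1.1.2 s.1.1.2.1 s.1.1.2.2) || adjHfun q H s.1.2 s.2) :=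
    (((adjG_codeFP.comp ((fst _ _).fst'.fst'.pair (fst _ _).fst'.snd')).not).or ((adjH_codeFP q H).comp ((fst _ _).snd'.pair (snd _ _)))).congr fun _ => rfl
  have hinner := optCases (σ := ((ℕ × List Bool) × (ℕ × ℕ)) × ℕ) (α := ℕ) (eσ := iE) (eα := natE) (eδ := bitE)
    (k := fun s o => match o with | none => true | some d => !(adjGfun s.1.1.1 s.1.1.2 s.1.2.1 s.1.2.2) || adjHfun q H s.2 d)
    (const _ true) hboth (fun _ => rfl) (fun _ _ => rfl)
  -- outer case analysis on the first colour, context `((ctx, i, j), o')`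
  let oE := pairE (pairE (pairE unE strE) (pairE natE natE)) (optE natE)
  have hsome : CodeFP (pairE oE natE) bitE
      (fun s => match s.1.2 with | none => true | some d => !(adjGfun s.1.1.1.1 s.1.1.1.2 s.1.1.2.1 s.1.1.2.2) || adjHfun q H s.2 d) :=
    (hinner.comp (((fst _ _).fst'.pair (snd _ _)).pair (fst _ _).snd')).congr fun _ => rfl
  have houter := optCases (σ := ((ℕ × List Bool) × (ℕ × ℕ)) × Option ℕ) (α := ℕ) (eσ := oE) (eα := natE) (eδ := bitE)
    (k := fun s o => match o with
      | none => true
      | some c => match s.2 with | none => true | some d => !(adjGfun s.1.1.1 s.1.1.2 s.1.2.1 s.1.2.2) || adjHfun q H c d)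
    (const _ true) hsome (fun _ => rfl) (fun _ _ => rfl)
  have pctx : CodeFP tE (pairE unE strE) (fun t => t.1) := fst _ _
  have pi : CodeFP tE natE (fun t => t.2.1.1) := (snd _ _).fst'.fst'
  have po : CodeFP tE (optE natE) (fun t => t.2.1.2) := (snd _ _).fst'.snd'
  have pj : CodeFP tE natE (fun t => t.2.2.1) := (snd _ _).snd'.fst'
  have po' : CodeFP tE (optE natE) (fun t => t.2.2.2) := (snd _ _).snd'.snd'
  refine ((houter.comp (((pctx.pair (pi.pair pj)).pair po').pair po)).congr fun t => ?_)
  rw [pairOK_eq]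

/-- `isHom` on codes (context `(1ⁿ, bits)`). [cite: AroraBarak2009, §1.3] -/
theorem isHom_codeFP : CodeFP (pairE (pairE unE strE) (rawE (optE natE))) bitE (fun p => isHom (adjHfun q H) (adjGfun p.1.1 p.1.2) p.2) := by
  let eE := rawE (pairE natE (optE natE))
  have henum : CodeFP (rawE (optE natE)) eE enum := (rawEnum (optE natE)).congr fun _ => rfl
  -- inner `all` over `enum t`, context `((ctx, enum t), p)`
  have hin := all (σ := ((ℕ × List Bool) × List (ℕ × Option ℕ)) × (ℕ × Option ℕ)) (eσ := pairE (pairE (pairE unE strE) eE) (pairE natE (optE natE)))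
    (eα := pairE natE (optE natE)) (p := fun s => pairOK (adjHfun q H) (adjGfun s.1.1.1.1 s.1.1.1.2) s.1.2 s.2)
    ((pairOK_codeFP q H).comp ((fst _ _).fst'.fst'.pair ((fst _ _).snd'.pair (snd _ _))))
  have hin' : CodeFP (pairE (pairE (pairE unE strE) eE) (pairE natE (optE natE))) bitE
      (fun s => s.1.2.all fun p' => pairOK (adjHfun q H) (adjGfun s.1.1.1 s.1.1.2) s.2 p') := (hin.comp ((CodeFP.id _).pair (fst _ _).snd')).congr fun _ => rfl
  have hout := all (σ := (ℕ × List Bool) × List (ℕ × Option ℕ)) (eσ := pairE (pairE unE strE) eE) (eα := pairE natE (optE natE)) hin'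
  exact ((hout.comp (((fst _ _).pair (henum.comp (snd _ _))).pair (henum.comp (snd _ _)))).congr fun p => rfl)

/-- **`homSecs` on codes** (context `(1ⁿ, bits)`). [cite: AroraBarak2009, §1.3] -/
theorem homSecs_codeFP : CodeFP (pairE unE strE) (rawE (rawE (optE natE))) (fun p => homSecs k q (adjHfun q H) p.1 (adjGfun p.1 p.2)) :=
  ((filter (σ := ℕ × List Bool) (eσ := (pairE unE strE)) (eα := (rawE (optE natE))) (isHom_codeFP q H)).comp ((CodeFP.id _).pair ((upTo_codeFP q k).comp (fst _ _)))).congr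
    fun _ => rfl

/-! ### The forth test -/

/-- `forthOK` on codes (context `(t, a)`, argument `t'`). [cite: AroraBarak2009, §1.3] -/
theorem forthOK_codeFP : CodeFP (pairE (pairE (rawE (optE natE)) natE) (rawE (optE natE))) bitE (fun p => forthOK p.1.1 p.2 p.1.2) := by
  let tE := pairE (pairE (rawE (optE natE)) natE) (rawE (optE natE))
  have pt : CodeFP tE (rawE (optE natE)) (fun p => p.1.1) := (fst _ _).fst'
  have pa : CodeFP tE natE (fun p => p.1.2) := (fst _ _).snd'
  have pt' : CodeFP tE (rawE (optE natE)) (fun p => p.2) := snd _ _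
  have get : CodeFP (pairE (rawE (optE natE)) natE) (optE natE) (fun q => q.1.getD q.2 none) := rawGetD (optE natE) (d := none) rfl
  have h1 : CodeFP tE bitE (fun p => (p.2.getD p.1.2 none).isSome) := ((optIsSome natE).comp (get.comp (pt'.pair pa))).congr fun _ => rfl
  have hset : CodeFP (pairE (rawE (optE natE)) natE) (rawE (optE natE)) (fun q => q.1.set q.2 none) := ((setAt (optE natE)).comp ((fst _ _).pair ((snd _ _).pair (const _ none)))).congr fun _ => rfl
  have h2 : CodeFP tE bitE (fun p => p.2.set p.1.2 none == p.1.1.set p.1.2 none) :=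
    (beqO_codeFP.comp ((hset.comp (pt'.pair pa)).pair (hset.comp (pt.pair pa)))).congr fun _ => rfl
  have h3 : CodeFP tE bitE (fun p => !(p.1.1.getD p.1.2 none).isSome || p.2 == p.1.1) :=
    (((optIsSome natE).comp (get.comp (pt.pair pa))).not.or (beqO_codeFP.comp (pt'.pair pt))).congr fun _ => rfl
  exact ((h1.and h2).and h3).congr fun _ => rfl

/-- **`forthL k` on codes** (context `(1ⁿ, S)`, argument `t`). [cite: AroraBarak2009, §1.3] -/
theorem forthL_codeFP : CodeFP (pairE (pairE unE (rawE (rawE (optE natE)))) (rawE (optE natE))) bitE (fun p => forthL k p.1.1 p.1.2 p.2) := by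
  let tE := pairE (pairE unE (rawE (rawE (optE natE)))) (rawE (optE natE))
  have hany := any (σ := OSec × ℕ) (eσ := pairE (rawE (optE natE)) natE) (eα := (rawE (optE natE))) forthOK_codeFP
  -- `(range n).all (fun a => S.any (forthOK t · a))`, context `(t, S)`, item `a`
  have hall := all (σ := OSec × List OSec) (eσ := pairE (rawE (optE natE)) (rawE (rawE (optE natE)))) (eα := natE)
    (p := fun s => s.1.2.any fun t' => forthOK s.1.1 t' s.2) (hany.comp (((fst _ _).fst'.pair (snd _ _)).pair (fst _ _).snd'))
  have h2 : CodeFP tE bitE (fun p => (List.range p.1.1).all fun a => p.1.2.any fun t' => forthOK p.2 t' a) :=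
    (hall.comp (((snd _ _).pair (fst _ _).snd').pair (urange.comp (fst _ _).fst'))).congr fun _ => rfl
  have h1 : CodeFP tE bitE (fun p => !decide ((domL p.2).length < k)) :=
    ((natLt.comp (((natLength natE).comp (domL_codeFP.comp (snd _ _))).pair (const _ k))).not).congr fun _ => rfl
  exact (h1.or h2).congr fun _ => rfl

/-! ### The linear system -/

/-- `ind` on codes. [folklore] -/
theorem ind_codeFP : CodeFP bitE intE ind :=
  ((CodeFP.id bitE).ite (const _ (1 : ℤ)) (const _ (0 : ℤ))).congr fun b => by cases b <;> rfl

/-- `pinRows` on codes. [cite: AroraBarak2009, §1.3] -/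
theorem pinRows_codeFP : CodeFP (pairE (rawE (rawE (optE natE))) (rawE (optE natE))) (rawE (pairE (rawE intE) intE)) (fun p => pinRows p.1 p.2) := by
  -- the row of `t`: `(S.map (ind (· == t)), ind (t == t₀))`, context `(S, t₀)`, item `t`
  let cE := pairE (rawE (rawE (optE natE))) (rawE (optE natE))
  have hcoef : CodeFP (pairE (rawE (optE natE)) (rawE (optE natE))) intE (fun q => ind (q.2 == q.1)) := (ind_codeFP.comp (beqO_codeFP.comp ((snd _ _).pair (fst _ _)))).congr fun _ => rfl
  have hrow : CodeFP (pairE cE (rawE (optE natE))) (pairE (rawE intE) intE) (fun s => (s.1.1.map fun t' => ind (t' == s.2), ind (s.2 == s.1.2))) :=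
    (((map (σ := OSec) (eσ := (rawE (optE natE))) (eα := (rawE (optE natE))) hcoef).comp ((snd _ _).pair (fst _ _).fst')).pair
      (ind_codeFP.comp (beqO_codeFP.comp ((snd _ _).pair (fst _ _).snd')))).congr fun _ => rfl
  have hmap := map (σ := List OSec × OSec) (eσ := cE) (eα := (rawE (optE natE))) hrow
  have hpred : CodeFP (pairE (rawE (optE natE)) (rawE (optE natE))) bitE (fun q => domL q.2 == domL q.1) := (beqV_codeFP.comp ((domL_codeFP.comp (snd _ _)).pair (domL_codeFP.comp (fst _ _)))).congr fun _ => rfl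
  have hfil : CodeFP cE (rawE (rawE (optE natE))) (fun p => p.1.filter fun t => domL t == domL p.2) :=
    ((filter (σ := OSec) (eσ := (rawE (optE natE))) (eα := (rawE (optE natE))) hpred).comp ((snd _ _).pair (fst _ _))).congr fun _ => rfl
  exact (hmap.comp ((CodeFP.id _).pair hfil)).congr fun _ => rfl

/-- `compatRow` on codes. [cite: AroraBarak2009, §1.3] -/
theorem compatRow_codeFP : CodeFP (pairE (rawE (rawE (optE natE))) (pairE (rawE natE) (pairE (rawE natE) (rawE (optE natE))))) (pairE (rawE intE) intE) (fun p => compatRow p.1 p.2.1 p.2.2.1 p.2.2.2) := by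
  -- coefficient of `t`, context `(Ul, Dl, ul)`
  let cE := pairE (rawE natE) (pairE (rawE natE) (rawE (optE natE)))
  let tE := pairE cE (rawE (optE natE))
  have pUl : CodeFP tE (rawE natE) (fun s => s.1.1) := (fst _ _).fst'
  have pDl : CodeFP tE (rawE natE) (fun s => s.1.2.1) := (fst _ _).snd'.fst'
  have pul : CodeFP tE (rawE (optE natE)) (fun s => s.1.2.2) := (fst _ _).snd'.snd'
  have pt : CodeFP tE (rawE (optE natE)) (fun s => s.2) := snd _ _
  have hA : CodeFP tE bitE (fun s => domL s.2 == s.1.1 && restrL s.2 s.1.2.1 == s.1.2.2) :=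
    ((beqV_codeFP.comp ((domL_codeFP.comp pt).pair pUl)).and (beqO_codeFP.comp ((restrL_codeFP.comp (pt.pair pDl)).pair pul))).congr fun _ => rfl
  have hcoef : CodeFP tE intE (fun s => ind (domL s.2 == s.1.1 && restrL s.2 s.1.2.1 == s.1.2.2) - ind (s.2 == s.1.2.2)) :=
    (intSub.comp ((ind_codeFP.comp hA).pair (ind_codeFP.comp (beqO_codeFP.comp (pt.pair pul))))).congr fun _ => rfl
  have hmap := map (σ := List ℕ × (List ℕ × OSec)) (eσ := cE) (eα := (rawE (optE natE))) hcoef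
  exact ((hmap.comp ((snd _ _).pair (fst _ _))).pair (const _ (0 : ℤ))).congr fun _ => rfl

/-- **`compatRows k q` on codes** (context `1ⁿ`, argument `S`). [cite: AroraBarak2009, §1.3] -/
theorem compatRows_codeFP : CodeFP (pairE unE (rawE (rawE (optE natE)))) (rawE (pairE (rawE intE) intE)) (fun p => compatRows k q p.1 p.2) := by
  -- innermost: `(colourings q n k Dl).map (compatRow S Ul Dl ·)`, context `((n, S), Ul, Dl)`
  let c3 := pairE (pairE unE (rawE (rawE (optE natE)))) (pairE (rawE natE) (rawE natE))
  have pn3 : CodeFP c3 unE (fun s => s.1.1) := (fst _ _).fst'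
  have pS3 : CodeFP c3 (rawE (rawE (optE natE))) (fun s => s.1.2) := (fst _ _).snd'
  have pUl3 : CodeFP c3 (rawE natE) (fun s => s.2.1) := (snd _ _).fst'
  have pDl3 : CodeFP c3 (rawE natE) (fun s => s.2.2) := (snd _ _).snd'
  have hrow : CodeFP (pairE c3 (rawE (optE natE))) (pairE (rawE intE) intE) (fun s => compatRow s.1.1.2 s.1.2.1 s.1.2.2 s.2) :=
    (compatRow_codeFP.comp ((pS3.comp (fst _ _)).pair ((pUl3.comp (fst _ _)).pair ((pDl3.comp (fst _ _)).pair (snd _ _))))).congr fun _ => rfl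
  have h3 : CodeFP c3 (rawE (pairE (rawE intE) intE)) (fun s => (colourings q s.1.1 k s.2.2).map fun ul => compatRow s.1.2 s.2.1 s.2.2 ul) :=
    ((map (σ := (ℕ × List OSec) × (List ℕ × List ℕ)) (eσ := c3) (eα := (rawE (optE natE))) hrow).comp ((CodeFP.id _).pair ((colourings_codeFP q k).comp (pn3.pair pDl3)))).congr fun _ => rfl
  -- middle: flatMap over `Dl ∈ subl k Ul`, context `((n, S), Ul)`
  let c2 := pairE (pairE unE (rawE (rawE (optE natE)))) (rawE natE)
  have h3' : CodeFP (pairE c2 (rawE natE)) (rawE (pairE (rawE intE) intE)) (fun s => (colourings q s.1.1.1 k s.2).map fun ul => compatRow s.1.1.2 s.1.2 s.2 ul) :=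
    (h3.comp ((fst _ _).fst'.pair ((fst _ _).snd'.pair (snd _ _)))).congr fun _ => rfl
  have h2 : CodeFP c2 (rawE (pairE (rawE intE) intE)) (fun s => (subl k s.2).flatMap fun Dl => (colourings q s.1.1 k Dl).map fun ul => compatRow s.1.2 s.2 Dl ul) :=
    ((flatten _).comp ((map (σ := (ℕ × List OSec) × List ℕ) (eσ := c2) (eα := (rawE natE)) h3').comp ((CodeFP.id _).pair ((subl_codeFP k).comp (snd _ _))))).congr
      fun s => by rw [List.flatMap_def]; rfl
  -- outer: flatMap over `Ul ∈ domsUpTo n k`, context `(n, S)`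
  have h1 : CodeFP (pairE unE (rawE (rawE (optE natE)))) (rawE (pairE (rawE intE) intE))
      (fun p => (domsUpTo p.1 k).flatMap fun Ul => (subl k Ul).flatMap fun Dl => (colourings q p.1 k Dl).map fun ul => compatRow p.2 Ul Dl ul) :=
    ((flatten _).comp ((map (σ := ℕ × List OSec) (eσ := pairE unE (rawE (rawE (optE natE)))) (eα := (rawE natE)) h2).comp ((CodeFP.id _).pair ((domsUpTo_codeFP k).comp (fst _ _))))).congr
      fun p => by rw [List.flatMap_def]; rfl
  exact h1.congr fun _ => rfl

/-- **`zextL detZ k q` on codes** (context `1ⁿ`, arguments `(S, t₀)`). [cite: OConghaile2022, §4.2] [cite: AroraBarak2009, §1.3] -/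
theorem zextL_codeFP : CodeFP (pairE unE (pairE (rawE (rawE (optE natE))) (rawE (optE natE)))) bitE (fun p => zextL detZ k q p.1 p.2.1 p.2.2) := by
  let tE := pairE unE (pairE (rawE (rawE (optE natE))) (rawE (optE natE)))
  have hrows : CodeFP tE (rawE (pairE (rawE intE) intE)) (fun p => eqRows k q p.1 p.2.1 p.2.2) :=
    ((rawAppend (pairE (rawE intE) intE)).comp ((pinRows_codeFP.comp (snd _ _)).pair ((compatRows_codeFP k q).comp ((fst _ _).pair (snd _ _).fst')))).congr
      fun _ => rfl
  have hA : CodeFP tE (rawE (rawE intE)) (fun p => (eqRows k q p.1 p.2.1 p.2.2).map Prod.fst) := ((map₀ (fst (rawE intE) intE)).comp hrows).congr fun _ => rfl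
  have hb : CodeFP tE (rawE intE) (fun p => (eqRows k q p.1 p.2.1 p.2.2).map Prod.snd) := ((map₀ (snd (rawE intE) intE)).comp hrows).congr fun _ => rfl
  have hc : CodeFP tE natE (fun p => p.2.1.length) := (natLength (rawE (optE natE))).comp (snd _ _).fst'
  exact (intSolvable_codeFP.comp (hc.pair (hA.pair hb))).congr fun _ => rfl

/-! ### The operator and the loop -/

/-- **`reduceL detZ k q` on codes** (context `1ⁿ`, argument `S`). [cite: OConghaile2022, §4.3.1] [cite: AroraBarak2009, §1.3] -/
theorem reduceL_codeFP : CodeFP (pairE unE (rawE (rawE (optE natE)))) (rawE (rawE (optE natE))) (fun p => reduceL detZ k q p.1 p.2) := by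
  have hpred : CodeFP (pairE (pairE unE (rawE (rawE (optE natE)))) (rawE (optE natE))) bitE (fun s => forthL k s.1.1 s.1.2 s.2 && zextL detZ k q s.1.1 s.1.2 s.2) :=
    ((forthL_codeFP k).and ((zextL_codeFP k q).comp ((fst _ _).fst'.pair ((fst _ _).snd'.pair (snd _ _))))).congr fun _ => rfl
  exact ((filter (σ := ℕ × List OSec) (eσ := pairE unE (rawE (rawE (optE natE)))) (eα := (rawE (optE natE))) hpred).comp ((CodeFP.id _).pair (snd _ _))).congr fun _ => rfl

/-- The loop as a left fold over a budget. [folklore] -/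
theorem foldl_reduceL (n : ℕ) (l : List Unit) (S : List OSec) :
    l.foldl (fun S _ => reduceL detZ k q n S) S = (reduceL detZ k q n)^[l.length] S := by
  induction l generalizing S with
  | nil => rfl
  | cons u l ih => rw [List.foldl_cons, ih, List.length_cons, Function.iterate_succ_apply]

/-- **`iterL detZ k q` on codes**: `(((1ⁿ, S), budget)) ↦ iterL … n |budget| S` (the state is a sublist
of `S`). [cite: OConghaile2022, §4.3.1] [cite: AroraBarak2009, §1.3 (polynomially bounded loops)] -/
theorem iterL_codeFP : CodeFP (pairE (pairE unE (rawE (rawE (optE natE)))) (rawE unitE)) (rawE (rawE (optE natE))) (fun p => iterL detZ k q p.1.1 p.2.length p.1.2) := by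
  let cE := pairE unE (rawE (rawE (optE natE)))
  have hstep := (reduceL_codeFP k q).comp ((fst cE (pairE unitE (rawE (rawE (optE natE))))).fst'.pair (snd cE (pairE unitE (rawE (rawE (optE natE))))).snd')
  have hfold := foldl (σ := ℕ × List OSec) (α := Unit) (β := List OSec) (eσ := cE) (eα := unitE) (eβ := (rawE (rawE (optE natE))))
    (step := fun s _ S => reduceL detZ k q s.1 S) (init := fun s => s.2) hstep (snd _ _) X (fun s l₁ l₂ => by
      obtain ⟨n, S⟩ := s
      have hsub := iterate_reduceL_sublist (D := detZ) (k := k) (q := q) (n := n) l₁.length S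
      change (rawE (rawE (optE natE)) (l₁.foldl (fun S _ => reduceL detZ k q n S) S)).length ≤ _
      rw [foldl_reduceL, eval_X, pairE_apply, length_boolPair]
      have := length_rawE_le_of_sublist (rawE (optE natE)) hsub
      simp only [cE, pairE_apply, length_boolPair]
      omega)
  exact hfold.congr fun p => by rw [iterL_eq_iterate, ← foldl_reduceL]

/-- **`decideL detZ k q (adjHfun q H)` on codes** (arguments `(1ⁿ, bits)`). [cite: OConghaile2022, Def. 5] [cite: AroraBarak2009, §1.3] -/
theorem decideL_codeFP : CodeFP (pairE unE strE) bitE (fun p => decideL detZ k q (adjHfun q H) p.1 (adjGfun p.1 p.2)) := by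
  have hS := homSecs_codeFP k q H
  have hbud : CodeFP (pairE unE strE) (rawE unitE) (fun p => List.replicate ((homSecs k q (adjHfun q H) p.1 (adjGfun p.1 p.2)).length + 1) ()) :=
    (replicateUnit.comp (unSucc.comp ((ulength (rawE (optE natE))).comp hS))).congr fun _ => rfl
  have hit := (iterL_codeFP k q).comp ((((fst unE strE).pair hS)).pair hbud)
  refine ((((rawIsEmpty (rawE (optE natE))).comp hit).not).congr fun p => ?_)
  simp only [decideL, List.length_replicate]

/-- **The decision procedure on graph codes `⟨bin n, bits⟩`**, the number of vertices taken in unary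
as `min n |bits|`. [cite: OConghaile2022, Appendix (proof of Prop. "efficient")] [cite: AroraBarak2009, §1.3] -/
theorem decide_codeFP :
    CodeFP (pairE natE strE) bitE (fun p => decideL detZ k q (adjHfun q H) (min p.1 p.2.length) (adjGfun (min p.1 p.2.length) p.2)) := by
  have hn : CodeFP (pairE natE strE) unE (fun p => min p.1 p.2.length) := unOfNatMin.comp ((strLength.comp (snd _ _)).pair (fst _ _))
  exact ((decideL_codeFP k q H).comp (hn.pair (snd _ _))).congr fun _ => rfl

/-! ### The named fact -/

/-- **Ó CONGHAILE'S EFFICIENCY PROPOSITION, GRAPH FORM**: for every fixed level `k` and fixed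
finite template graph `H`, the language of codes of finite graphs `G` with `G →^ℤ_k H` is in `P`.
[cite: OConghaile2022, §4.2–§4.3.1 and Appendix (proof of Prop. "efficient")] -/
theorem mem_P (k q : ℕ) (H : SimpleGraph (Fin q)) :
    encodingGraph.toLanguage {G : Σ n, SimpleGraph (Fin n) | GraphCohomologicallyKConsistent k G.2 H} ∈ Classes.P := by
  classical
  -- the decider in `FP`
  obtain ⟨f, hf, hfspec⟩ := decide_codeFP k q H
  have hcode : CodeFP strE bitE (fun w => decide (HamNP.gcodeT w = [true])) :=
    (CodeFP.eq (α := List Bool) (eα := strE) Function.injective_id).comp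
      ((CodeFP.of_fn (eα := strE) (eβ := strE) (g := HamNP.gcodeT) HamNP.gcodeT HamNP.gcodeT_mem_FP (fun _ => rfl)).pair (const _ [true]))
  have hrun : CodeFP strE bitE (fun w => decide (f w = [true])) :=
    (CodeFP.eq (α := List Bool) (eα := strE) Function.injective_id).comp
      ((CodeFP.of_fn (eα := strE) (eβ := strE) (g := f) f hf (fun _ => rfl)).pair (const _ [true]))
  obtain ⟨g, hg, hgspec⟩ := hcode.and hrun
  -- on the code of a graph the program answers the question
  have hf_encode : ∀ (n : ℕ) (G : SimpleGraph (Fin n)),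
      f (encodingGraph.encode ⟨n, G⟩) = [decide (GraphCohomologicallyKConsistent k G H)] := by
    intro n G
    have e : encodingGraph.encode ⟨n, G⟩ = pairE natE strE (n, CliqueNP.adjBits n G) := by
      rw [encodingGraph_encode, CliqueNP.encodingGraphFin_encode_eq]; rfl
    rw [e, hfspec]
    have hmin : min n (CliqueNP.adjBits n G).length = n := by
      rw [CliqueNP.length_adjBits]; exact min_eq_left (Nat.le_mul_self n)
    simp only [hmin]
    change [decideL detZ k q (adjHfun q H) n (adjGfun n (CliqueNP.adjBits n G))] = _
    congr 1
    rw [Bool.eq_iff_iff, decide_eq_true_iff]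
    exact decideL_eq_true_iff RowSelectFP.detCorrect_detZ (adjHfun_fin q H) (adjGfun_adjBits G)
  -- the language is cut out by `g`
  refine mem_P_of_mem_FP hg _ fun w => ?_
  have hgw : g w = [decide (HamNP.gcodeT w = [true]) && decide (f w = [true])] := hgspec w
  constructor
  · rintro ⟨⟨n, G⟩, hG, rfl⟩
    rw [hgw, (HamNP.gcodeT_eq_true_iff _).2 ⟨n, G, rfl⟩, hf_encode]
    simp only [Set.mem_setOf_eq] at hG
    simp [hG]
  · intro hw
    rw [hgw]
    by_cases hc : HamNP.gcodeT w = [true]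
    · obtain ⟨n, G, rfl⟩ := (HamNP.gcodeT_eq_true_iff w).1 hc
      rw [hf_encode]
      have hG : ¬ GraphCohomologicallyKConsistent k G H := fun hG => hw ⟨⟨n, G⟩, hG, rfl⟩
      simp [hG]
    · simp [hc]

end GCKCFP

/-- **Discharge of the named fact `graphCohomologicalKConsistency_mem_P`** (Ó Conghaile 2022,
Prop. "efficient", graph/fixed-template form): for every fixed `k` and fixed finite template `H`, the
codes of the finite graphs `G` with `G →^ℤ_k H` form a language in `P` — by running the cohomological
`k`-consistency algorithm (`GCKCDecide.decideL`, `≤ |𝓗_k| + 1` rounds of `(·)^{ℤ↓}`, each `ℤext` test a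
linear Diophantine system decided in polynomial time) as a polynomial-time string function.
[cite: OConghaile2022, §4.2–§4.3.1 and Appendix (proof of Prop. "efficient")] -/
theorem graphCohomologicalKConsistency_mem_P_holds : graphCohomologicalKConsistency_mem_P :=
  fun k q H => GCKCFP.mem_P k q H

end Literature.ModelTheory.FiniteModelTheory
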